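import Summits.Schanuel.Schanuel.Theorems.RootDecomp1KB3LiouvilleSector01

/-!
# RootDecomp1KB3LiouvilleSector — lens 6, generation 26, node 1 «THE RESIDUAL HIDES A LIOUVILLE SECTOR — AND A₁ ALREADY OWNS IT» (CLAIM L2380, PRICE + CHECKLIST G31-α L2383 (ruling (11): RECORD-ONLY, no item / route edit), NODE L2385 / REQUEST L2386; critic VERDICT L2388: CLEARED — CELL ×1 «algebraic-translate Liouville cell z⋆(α, b) strictly inside 31987» + AUDIT/THEOREM ×1 «residual shrink certificate 31987 = B₃ᴸ ∧ B₄, B₃ᴸ ⟸ 31077»; RULE G31; PORT GO) — continuation (RootDecomp1KB3LiouvilleSector02): §3 the cell z⋆(α, b), §4 re-carving of the residual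

(lens-6 g26 HOME kernel K = HOME/decomp-schanuel-lens-6/g26/B3LiouvilleSector.lean db3352fb…, 652 l, imports Theses.RootDecomp1K + Theorems RootDecomp1KNWMeasureHolds / RootDecomp1KB3LogBarrier03 + Literature Barriers NesterenkoModularScopeConjectureProofs; P/C + NODE-g26.md. Port by census-1 gen 20 as `RootDecomp1KB3LiouvilleSector01–02`: 01 = §1 KERNEL `not_liouville_algebraic_add_liouvilleNumber (hα : IsAlgebraic ℚ α) (hirr : Irrational α) (hb : 2 ≤ b) : ¬ Liouville (α + liouvilleNumber b)` (LeVeque-window / Bugeaud §7.6 method; new in tree) + §2 field bookkeeping and the lever-exact level-2 storey `sb_two_of_isAlgebraic_polyMeasure_liouville`; 02 = §3 THE CELL `zStar α b = ![1, α + ℓ_b]` strictly inside B₃ decided hypothesis-free (`polyDiophantineSchanuel_at_zStar`, the three live B₃ binders at z⋆) + §4 RE-CARVING `AlgLiouvilleAdjacent` (P⁺), `AlgLiouvilleSectorSchanuel` (B₃ᴸ), `AlgDiophantineSchanuel` (B₄), `polyDiophantineSchanuel_iff : B₃ ↔ B₃ᴸ ∧ B₄`, transport `algLiouvilleSector_of_coordLiouvilleSchanuel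 : CoordLiouvilleSchanuel → AlgLiouvilleSectorSchanuel`, `closes_shrunk`, `algDiophantineSchanuel_of_schanuel`, shrink witness `zStar_mem_B3_not_B4`, flagship certificates `not_algLiouvilleAdjacent_one_piI` / (1, e) ∈ B₄.
PORT EDITS (sanctioned in VERDICT L2388 (a)–(c)): linter option dropped; two one-line docstrings added (`zStar_zero`, `zStar_one`); the three `def … : Prop` carry the census statement tags — `AlgLiouvilleAdjacent` «[carving predicate] definition», `AlgLiouvilleSectorSchanuel` / `AlgDiophantineSchanuel` «[restriction] definition — NOT a fact and NOT a new obligation; equals the live B₃ body plus one binder» (ruling (11): RECORD-ONLY) — and part 02 is filed definition-kind (review lane); two generic helpers `trdeg_mono` (≡ Literature.Barriers.Schanuel.trdeg_mono) and `trdeg_adjoin_le_mk` (≡ RootDecomp1DFlagSplit.trdeg_adjoin_le_cardinalMk) made PRIVATE after the dry-run dedup.landed finding (private copy of the latter in 02); statements and proofs verbatim, no renames of the nine checklist decls. `--supports stmt-Schanuel-31987`; no census credit carried; rung 0 — nothing here proves Schanuel; no item closes.)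
-/

noncomputable section

open Polynomial LiouvilleNumber Real Complex IntermediateField
open scoped Nat

namespace Summit.Schanuel.Schanuel.Theorems.RootDecomp1KB3LiouvilleSector

open Summit.Schanuel.Schanuel.Theorems.RootDecomp1KHyper

/-- A field generated by `S` has transcendence degree `≤ #S` (copy of the tree's
`Literature.NumberTheory.Transcendental.trdeg_adjoin_le_mk`, whose module is outside this cone). -/
private theorem trdeg_adjoin_le_mk {F E : Type*} [Field F] [Field E] [Algebra F E] (S : Set E) :
    Algebra.trdeg F ↥(adjoin F S) ≤ Cardinal.mk S := by
  haveI := Literature.NumberTheory.Transcendental.isAlgebraic_adjoin_over_algebraAdjoin (F := F) S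
  exact (Algebra.IsAlgebraic.trdeg_le_cardinalMk F (((↑) : adjoin F S → E) ⁻¹' S)).trans
    (Cardinal.mk_preimage_of_injective _ _ Subtype.val_injective)

/-! ## §3. THE CELL `z⋆(α, b) = (1, α + ℓ_b)` — strictly inside `B₃`, decided hypothesis-free -/

/-- The crypto-Liouville pair `z⋆(α, b) = (1, α + ℓ_b)`. -/
def zStar (α : ℝ) (b : ℕ) : Fin 2 → ℂ := ![(1 : ℂ), ((α + liouvilleNumber b : ℝ) : ℂ)]

/-- `z⋆ 0 = 1`. -/
@[simp] theorem zStar_zero (α : ℝ) (b : ℕ) : zStar α b 0 = 1 := rfl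
/-- `z⋆ 1 = α + ℓ_b`. -/
@[simp] theorem zStar_one (α : ℝ) (b : ℕ) : zStar α b 1 = ((α + liouvilleNumber b : ℝ) : ℂ) := rfl

/-- `z⋆` is ℚ-free (its ratio `α + ℓ_b` is irrational). -/
theorem linearIndependent_zStar {α : ℝ} (hα : IsAlgebraic ℚ α) {b : ℕ} (hb : 2 ≤ b) :
    LinearIndependent ℚ (zStar α b) := by
  have h := linearIndependent_pair_of_irrational (t := (1 : ℂ)) one_ne_zero
    (irrational_algebraic_add_liouvilleNumber hα hb)
  rw [mul_one] at h
  exact h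

/-- **First live binder of `B₃`:** no vector of the ℚ-span of `z⋆` has a Liouville coordinate
(real parts are `c₀ + c₁(α + ℓ_b)`, imaginary parts vanish) — by the KERNEL THEOREM. -/
theorem not_coordLiouville_zStar {α : ℝ} (hα : IsAlgebraic ℚ α) (hirr : Irrational α) {b : ℕ}
    (hb : 2 ≤ b) :
    ¬ ∃ w ∈ Submodule.span ℚ (Set.range (zStar α b)), Liouville w.re ∨ Liouville w.im := by
  rintro ⟨w, hw, hLw⟩
  obtain ⟨c, rfl⟩ := (Submodule.mem_span_range_iff_exists_fun ℚ).mp hw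
  simp only [Fin.sum_univ_two, zStar_zero, zStar_one, Rat.smul_def] at hLw
  rcases hLw with hre | him
  · have hq : (((c 0 : ℂ) * 1 + (c 1 : ℂ) * ((α + liouvilleNumber b : ℝ) : ℂ)).re : ℝ)
        = (c 1 : ℝ) * (α + liouvilleNumber b) + (c 0 : ℚ) := by
      simp [Complex.mul_re]; ring
    rw [hq] at hre
    by_cases hc1 : c 1 = 0
    · rw [hc1] at hre
      simp only [Rat.cast_zero, zero_mul, zero_add] at hre
      exact not_liouville_ratCast (c 0) hre
    · exact not_liouville_algebraic_add_liouvilleNumber hα hirr hb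
        ((liouville_rat_mul_add_rat_iff hc1).mp hre)
  · have hq : (((c 0 : ℂ) * 1 + (c 1 : ℂ) * ((α + liouvilleNumber b : ℝ) : ℂ)).im : ℝ) = ((0 : ℚ) : ℝ) := by
      simp [Complex.mul_im]
    rw [hq] at him
    exact not_liouville_ratCast 0 him

/-- **Second live binder of `B₃`:** `z⋆` is not `LinLiouville` (its ratio is not Liouville, by
the KERNEL THEOREM and the tree's `exists_liouville_ratio_of_linLiouville`). -/
theorem not_linLiouville_zStar {α : ℝ} (hα : IsAlgebraic ℚ α) (hirr : Irrational α) {b : ℕ}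
    (hb : 2 ≤ b) :
    ¬ ∀ ω : ℕ, ∃ h : Fin 2 → ℤ, h ≠ 0 ∧
      ‖∑ i, (h i : ℂ) * zStar α b i‖ < 1 / (1 + ∑ i, (|h i| : ℝ)) ^ ω := by
  intro hlin
  obtain ⟨ρ, hρ, h1⟩ := exists_liouville_ratio_of_linLiouville (linearIndependent_zStar hα hb) hlin
  rw [zStar_one, zStar_zero, mul_one] at h1
  have hρ' : ρ = α + liouvilleNumber b := by exact_mod_cast h1.symm
  exact not_liouville_algebraic_add_liouvilleNumber hα hirr hb (hρ' ▸ hρ)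

/-- `ℓ_b = (α + ℓ_b) − α` is algebraic over the Schanuel field of `z⋆` (indeed over `ℚ(z⋆)`). -/
theorem isAlgebraic_liouvilleNumber_adjoin_range_zStar {α : ℝ} (hα : IsAlgebraic ℚ α) (b : ℕ) :
    IsAlgebraic ↥(adjoin ℚ (Set.range (zStar α b))) ((liouvilleNumber b : ℝ) : ℂ) := by
  set K := adjoin ℚ (Set.range (zStar α b)) with hK
  have hmem : ((α + liouvilleNumber b : ℝ) : ℂ) ∈ K := subset_adjoin ℚ _ ⟨1, rfl⟩
  have h1 : IsIntegral K (((α + liouvilleNumber b : ℝ) : ℂ)) :=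
    (isAlgebraic_algebraMap (⟨_, hmem⟩ : K)).isIntegral
  have hαC : IsAlgebraic ℚ ((α : ℝ) : ℂ) := hα.algebraMap
  have h2 : IsIntegral K ((α : ℝ) : ℂ) := (hαC.tower_top (L := K)).isIntegral
  have h3 := h1.sub h2
  have e : ((α + liouvilleNumber b : ℝ) : ℂ) - ((α : ℝ) : ℂ) = ((liouvilleNumber b : ℝ) : ℂ) := by
    push_cast; ring
  rw [e] at h3
  exact h3.isAlgebraic

/-- **Schanuel's bound at `z⋆` — hypothesis-free** (`e = e^{z⋆₀}` measured by the tree's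
`nwMeasure_holds`, `ℓ_b` Liouville and algebraic over `ℚ(z⋆)`; lever-exact storey §2). -/
theorem sb_zStar {α : ℝ} (hα : IsAlgebraic ℚ α) {b : ℕ} (hb : 2 ≤ b) : SB 2 (zStar α b) := by
  refine sb_two_of_isAlgebraic_polyMeasure_liouville
    (polyMeasure_exp_one_of_NW RootDecomp1KNWMeasureHolds.nwMeasure_holds)
    (liouville_liouvilleNumber hb) ?_ ?_
  · have hmem : cexp 1 ∈ adjoin ℚ (SFset (zStar α b)) :=
      subset_adjoin ℚ _ (Or.inr ⟨0, by simp⟩)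
    exact isAlgebraic_algebraMap (⟨_, hmem⟩ : adjoin ℚ (SFset (zStar α b)))
  · exact isAlgebraic_of_le (adjoin.mono ℚ _ _ Set.subset_union_left)
      (isAlgebraic_liouvilleNumber_adjoin_range_zStar hα b)

/-- **THE CELL, in the LIVE item's literal shape** (`B₃ = PolyDiophantineSchanuel` at `n = 2`,
`z = z⋆(α, b)`): all three binders are MET (previous theorems) and the conclusion HOLDS —
hypothesis-free, for every real algebraic irrational `α` and every base `b ≥ 2`. -/
theorem polyDiophantineSchanuel_at_zStar {α : ℝ} (hα : IsAlgebraic ℚ α) {b : ℕ} (hb : 2 ≤ b)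
    (_h₁ : LinearIndependent ℚ (zStar α b))
    (_h₂ : ¬ ∃ w ∈ Submodule.span ℚ (Set.range (zStar α b)), Liouville w.re ∨ Liouville w.im)
    (_h₃ : ¬ ∀ ω : ℕ, ∃ h : Fin 2 → ℤ, h ≠ 0 ∧
      ‖∑ i, (h i : ℂ) * zStar α b i‖ < 1 / (1 + ∑ i, (|h i| : ℝ)) ^ ω) :
    ((2 : ℕ) : Cardinal) ≤ Algebra.trdeg ℚ
      ↥(IntermediateField.adjoin ℚ (Set.range (zStar α b) ∪ Set.range (Complex.exp ∘ zStar α b))) :=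
  sb_zStar hα hb

/-- The cell is IN SCOPE of `B₃`: its three binders hold at `z⋆(α, b)` (hypothesis-free). -/
theorem zStar_mem_scope_B3 {α : ℝ} (hα : IsAlgebraic ℚ α) (hirr : Irrational α) {b : ℕ}
    (hb : 2 ≤ b) :
    LinearIndependent ℚ (zStar α b) ∧
    (¬ ∃ w ∈ Submodule.span ℚ (Set.range (zStar α b)), Liouville w.re ∨ Liouville w.im) ∧
    (¬ ∀ ω : ℕ, ∃ h : Fin 2 → ℤ, h ≠ 0 ∧
      ‖∑ i, (h i : ℂ) * zStar α b i‖ < 1 / (1 + ∑ i, (|h i| : ℝ)) ^ ω) :=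
  ⟨linearIndependent_zStar hα hb, not_coordLiouville_zStar hα hirr hb, not_linLiouville_zStar hα hirr hb⟩

/-- A hyper-Liouville system of small forms is in particular a `LinLiouville` one
(`exp(−y) < 1/y` for `y = (1 + Σ|hᵢ|)^m ≥ 1`). -/
theorem linLiouville_of_hyper {n : ℕ} {z : Fin n → ℂ}
    (hyp : ∀ m : ℕ, ∃ h : Fin n → ℤ, h ≠ 0 ∧
      ‖∑ i, (h i : ℂ) * z i‖ < Real.exp (-((1 + ∑ i, (|h i| : ℝ)) ^ m))) :
    ∀ ω : ℕ, ∃ h : Fin n → ℤ, h ≠ 0 ∧ ‖∑ i, (h i : ℂ) * z i‖ < 1 / (1 + ∑ i, (|h i| : ℝ)) ^ ω := by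
  intro ω
  obtain ⟨h, hh, hlt⟩ := hyp ω
  refine ⟨h, hh, hlt.trans_le ?_⟩
  set y : ℝ := (1 + ∑ i, (|h i| : ℝ)) ^ ω with hy
  have hy1 : 1 ≤ y := one_le_pow₀ (by linarith [hsum_nonneg h])
  have hypos : 0 < y := by linarith
  rw [Real.exp_neg, ← one_div]
  exact one_div_le_one_div_of_le hypos (by linarith [Real.add_one_le_exp y])

/-- **POSITION.** `z⋆` meets NO live A-item's hypothesis: not `31077`'s (no Liouville coordinate
in the span), not `33363`'s (not hyper-Liouville), not `33364`'s (not `LinLiouville`) — it is a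
tuple of the residual's scope, decided by no A-item AS STATED. -/
theorem zStar_outside_A_items {α : ℝ} (hα : IsAlgebraic ℚ α) (hirr : Irrational α) {b : ℕ}
    (hb : 2 ≤ b) :
    (¬ ∃ w ∈ Submodule.span ℚ (Set.range (zStar α b)), Liouville w.re ∨ Liouville w.im) ∧
    (¬ ∀ m : ℕ, ∃ h : Fin 2 → ℤ, h ≠ 0 ∧
      ‖∑ i, (h i : ℂ) * zStar α b i‖ < Real.exp (-((1 + ∑ i, (|h i| : ℝ)) ^ m))) ∧
    (¬ ∀ ω : ℕ, ∃ h : Fin 2 → ℤ, h ≠ 0 ∧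
      ‖∑ i, (h i : ℂ) * zStar α b i‖ < 1 / (1 + ∑ i, (|h i| : ℝ)) ^ ω) :=
  ⟨not_coordLiouville_zStar hα hirr hb,
    fun hyp => not_linLiouville_zStar hα hirr hb (linLiouville_of_hyper hyp),
    not_linLiouville_zStar hα hirr hb⟩

/-! ## §4. RE-CARVING THE RESIDUAL: `B₃ ⟺ B₃ᴸ ∧ B₄`, and `A₁` already proves `B₃ᴸ` -/

/-- [carving predicate] definition (membership predicate with parameters, NOT a fact; census convention, critic
L2388 (a)): **the cut `P⁺`** — the coordinate field `ℚ(z)` is algebraic-adjacent to a Liouville number. -/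
def AlgLiouvilleAdjacent {n : ℕ} (z : Fin n → ℂ) : Prop :=
  ∃ L : ℝ, Liouville L ∧ IsAlgebraic ↥(IntermediateField.adjoin ℚ (Set.range z)) (L : ℂ)

/-- [restriction] definition — NOT a fact and NOT a new obligation (census convention; critic ruling (11) L2383:
RECORD-ONLY, no item is added; equals the live B₃ body plus ONE binder, see `polyDiophantineSchanuel_iff`): **`B₃ᴸ = AlgLiouvilleSectorSchanuel`** — the live `B₃` body (stmt-Schanuel-31987)
with the extra binder `P⁺`. -/
def AlgLiouvilleSectorSchanuel : Prop :=
  ∀ (n : ℕ) (z : Fin n → ℂ), LinearIndependent ℚ z →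
    (¬ ∃ w ∈ Submodule.span ℚ (Set.range z), Liouville w.re ∨ Liouville w.im) →
    (¬ ∀ ω : ℕ, ∃ h : Fin n → ℤ, h ≠ 0 ∧ ‖∑ i, (h i : ℂ) * z i‖ < 1 / (1 + ∑ i, (|h i| : ℝ)) ^ ω) →
    (∃ L : ℝ, Liouville L ∧ IsAlgebraic ↥(IntermediateField.adjoin ℚ (Set.range z)) (L : ℂ)) →
    (n : Cardinal) ≤ Algebra.trdeg ℚ ↥(IntermediateField.adjoin ℚ (Set.range z ∪ Set.range (Complex.exp ∘ z)))

/-- [restriction] definition — NOT a fact and NOT a new obligation (census convention; critic ruling (11) L2383: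
RECORD-ONLY, no item is added; equals the live B₃ body plus ONE binder, see `polyDiophantineSchanuel_iff`): **`B₄ = AlgDiophantineSchanuel`** — the SHRUNK RESIDUAL: the live `B₃` body
(stmt-Schanuel-31987) with the extra binder `¬P⁺` (no Liouville number is algebraic over the coordinate field). -/
def AlgDiophantineSchanuel : Prop :=
  ∀ (n : ℕ) (z : Fin n → ℂ), LinearIndependent ℚ z →
    (¬ ∃ w ∈ Submodule.span ℚ (Set.range z), Liouville w.re ∨ Liouville w.im) →
    (¬ ∀ ω : ℕ, ∃ h : Fin n → ℤ, h ≠ 0 ∧ ‖∑ i, (h i : ℂ) * z i‖ < 1 / (1 + ∑ i, (|h i| : ℝ)) ^ ω) →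
    (¬ ∃ L : ℝ, Liouville L ∧ IsAlgebraic ↥(IntermediateField.adjoin ℚ (Set.range z)) (L : ℂ)) →
    (n : Cardinal) ≤ Algebra.trdeg ℚ ↥(IntermediateField.adjoin ℚ (Set.range z ∪ Set.range (Complex.exp ∘ z)))

/-- **EXACTNESS of the carving**: `B₃ ⟺ B₃ᴸ ∧ B₄` (excluded middle on `P⁺`). -/
theorem polyDiophantineSchanuel_iff :
    Summit.Schanuel.Schanuel.Theses.RootDecomp1K.PolyDiophantineSchanuel ↔
      AlgLiouvilleSectorSchanuel ∧ AlgDiophantineSchanuel := by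
  constructor
  · intro hB
    exact ⟨fun n z hz h₁ h₂ _ => hB n z hz h₁ h₂, fun n z hz h₁ h₂ _ => hB n z hz h₁ h₂⟩
  · rintro ⟨hS, hD⟩ n z hz h₁ h₂
    by_cases hP : ∃ L : ℝ, Liouville L ∧ IsAlgebraic ↥(IntermediateField.adjoin ℚ (Set.range z)) (L : ℂ)
    · exact hS n z hz h₁ h₂ hP
    · exact hD n z hz h₁ h₂ hP

/-- The generating set of the padded tuple `(L, z)`. -/
theorem sfset_cons {n : ℕ} (z : Fin n → ℂ) (L : ℂ) :
    Set.range (Fin.cons L z : Fin (n + 1) → ℂ) ∪ Set.range (cexp ∘ (Fin.cons L z : Fin (n + 1) → ℂ))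
      = (Set.range z ∪ Set.range (cexp ∘ z)) ∪ {L, cexp L} := by
  rw [Fin.comp_cons, Fin.range_cons, Fin.range_cons]
  ext x
  simp only [Set.mem_union, Set.mem_insert_iff, Set.mem_singleton_iff]
  tauto

/-- **TRANSPORT: `A₁ = CoordLiouvilleSchanuel` (stmt-Schanuel-31077) ALREADY PROVES `B₃ᴸ`.**
Pad `z` with the adjacent Liouville number `L`: `(L, z)` is ℚ-free because `B₃`'s own
coordinate binder forbids `L ∈ span_ℚ z`; `A₁` at `(L, z)` gives `n + 1 ≤ trdeg ℚ(L, z, e^L, e^z)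
≤ trdeg ℚ(z, e^z) + 0 + 1` (`L` algebraic over `ℚ(z)`, one new exponential). -/
theorem algLiouvilleSector_of_coordLiouvilleSchanuel
    (hA : Summit.Schanuel.Schanuel.Theses.RootDecomp1K.CoordLiouvilleSchanuel) :
    AlgLiouvilleSectorSchanuel := by
  intro n z hz hcoord _ hP
  obtain ⟨L, hL, hLalg⟩ := hP
  -- the padded tuple
  set z' : Fin (n + 1) → ℂ := Fin.cons (L : ℂ) z with hz'
  have hLspan : (L : ℂ) ∉ Submodule.span ℚ (Set.range z) := fun hmem =>
    hcoord ⟨(L : ℂ), hmem, Or.inl (by simpa using hL)⟩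
  have hz'li : LinearIndependent ℚ z' := hz.finCons hLspan
  have hw : ∃ w ∈ Submodule.span ℚ (Set.range z'), Liouville w.re ∨ Liouville w.im :=
    ⟨(L : ℂ), Submodule.subset_span ⟨0, by simp [hz']⟩, Or.inl (by simpa using hL)⟩
  have hA' := hA (n + 1) z' hz'li hw
  -- upper bound for the padded Schanuel field
  set S : Set ℂ := Set.range z ∪ Set.range (cexp ∘ z) with hS
  have hset : Set.range z' ∪ Set.range (cexp ∘ z') = S ∪ {(L : ℂ), cexp L} := by
    rw [hz', hS]; exact sfset_cons z L
  have hins : (S ∪ {(L : ℂ), cexp L} : Set ℂ) = (S ∪ {(L : ℂ)}) ∪ {cexp L} := by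
    rw [Set.insert_eq, ← Set.union_assoc]
  have hLalgS : IsAlgebraic ↥(adjoin ℚ S) (L : ℂ) :=
    isAlgebraic_of_le (adjoin.mono ℚ _ _ Set.subset_union_left) hLalg
  have heq : Algebra.trdeg ℚ ↥(adjoin ℚ (S ∪ {(L : ℂ)})) = Algebra.trdeg ℚ ↥(adjoin ℚ S) :=
    Literature.Barriers.Schanuel.trdeg_adjoin_union_eq_of_isAlgebraic_adjoin (K := ℚ) S {(L : ℂ)}
      (fun x hx => by rw [Set.mem_singleton_iff] at hx; rw [hx]; exact hLalgS)
  have hup : Algebra.trdeg ℚ ↥(adjoin ℚ (Set.range z' ∪ Set.range (cexp ∘ z')))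
      ≤ Algebra.trdeg ℚ ↥(adjoin ℚ S) + 1 := by
    rw [hset, hins]
    calc Algebra.trdeg ℚ ↥(adjoin ℚ ((S ∪ {(L : ℂ)}) ∪ {cexp L}))
        ≤ Algebra.trdeg ℚ ↥(adjoin ℚ (S ∪ {(L : ℂ)})) + Cardinal.mk ({cexp (L : ℂ)} : Set ℂ) :=
          trdeg_adjoin_union_le_add_mk _ _
      _ = Algebra.trdeg ℚ ↥(adjoin ℚ S) + 1 := by rw [heq, Cardinal.mk_singleton]
  have hfin : ((n + 1 : ℕ) : Cardinal) ≤ Algebra.trdeg ℚ ↥(adjoin ℚ S) + 1 := hA'.trans hup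
  have e : ((n + 1 : ℕ) : Cardinal) = (n : Cardinal) + 1 := by push_cast; rfl
  rw [e] at hfin
  exact (Cardinal.add_le_add_iff_of_lt_aleph0 Cardinal.one_lt_aleph0).mp hfin

/-- `A₁ ∧ B₄ ⟹ B₃`: the residual's Liouville sector is absorbed by the existing piece `A₁`. -/
theorem polyDiophantineSchanuel_of_coordLiouville_of_algDiophantine
    (hA : Summit.Schanuel.Schanuel.Theses.RootDecomp1K.CoordLiouvilleSchanuel)
    (hB₄ : AlgDiophantineSchanuel) :
    Summit.Schanuel.Schanuel.Theses.RootDecomp1K.PolyDiophantineSchanuel :=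
  polyDiophantineSchanuel_iff.mpr ⟨algLiouvilleSector_of_coordLiouvilleSchanuel hA, hB₄⟩

/-- **`closes` WITH THE SHRUNK RESIDUAL** — same four piece slots as the live
`RootDecomp1K.closes`, the declared residual `B₃` replaced by `B₄ ⊊ B₃`. -/
theorem closes_shrunk
    (hL : Summit.Schanuel.Schanuel.Theses.RootDecomp1K.CoordLiouvilleSchanuel)
    (hH : Summit.Schanuel.Schanuel.Theses.RootDecomp1K.HyperLiouvilleSchanuel)
    (hF : Summit.Schanuel.Schanuel.Theses.RootDecomp1K.FiniteOrderLiouvilleSchanuel)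
    (hB₄ : AlgDiophantineSchanuel) : _root_.Schanuel :=
  Summit.Schanuel.Schanuel.Theses.RootDecomp1K.closes hL hH hF
    (polyDiophantineSchanuel_of_coordLiouville_of_algDiophantine hL hB₄)

/-- NECESSITY: `Schanuel ⟹ B₄` (so the shrunk residual is still a consequence of the summit). -/
theorem algDiophantineSchanuel_of_schanuel (h : _root_.Schanuel) : AlgDiophantineSchanuel :=
  fun n z hz _ _ _ => h n z hz

/-- `B₃ ⟹ B₄` (the shrink is a weakening of the residual, never a strengthening). -/
theorem algDiophantineSchanuel_of_polyDiophantineSchanuel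
    (h : Summit.Schanuel.Schanuel.Theses.RootDecomp1K.PolyDiophantineSchanuel) :
    AlgDiophantineSchanuel :=
  (polyDiophantineSchanuel_iff.mp h).2

/-- **EXPLICIT SHRINK WITNESS.** Every cell `z⋆(α, b)` lies in the scope of `B₃` (§3) AND
satisfies `P⁺` (with `L = ℓ_b`), hence lies OUTSIDE the scope of `B₄`: the residual's scope
strictly shrinks, by explicitly named tuples. -/
theorem algLiouvilleAdjacent_zStar {α : ℝ} (hα : IsAlgebraic ℚ α) {b : ℕ} (hb : 2 ≤ b) :
    AlgLiouvilleAdjacent (zStar α b) :=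
  ⟨liouvilleNumber b, liouville_liouvilleNumber hb, isAlgebraic_liouvilleNumber_adjoin_range_zStar hα b⟩

/-- `√2` is algebraic over `ℚ` (root of `X² − 2`). -/
theorem isAlgebraic_sqrt_two : IsAlgebraic ℚ (Real.sqrt 2) := by
  refine ⟨X ^ 2 - C 2, X_pow_sub_C_ne_zero (by norm_num) 2, ?_⟩
  simp [Real.sq_sqrt]

/-- **The named witness `z⋆(√2, 2) = (1, √2 + Σ 2^{-k!})`**: in scope of `B₃`, decided
(`SB 2`), and `P⁺` — so NOT in scope of `B₄`. -/
theorem zStar_mem_B3_not_B4 :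
    (LinearIndependent ℚ (zStar (Real.sqrt 2) 2) ∧
      (¬ ∃ w ∈ Submodule.span ℚ (Set.range (zStar (Real.sqrt 2) 2)), Liouville w.re ∨ Liouville w.im) ∧
      (¬ ∀ ω : ℕ, ∃ h : Fin 2 → ℤ, h ≠ 0 ∧
        ‖∑ i, (h i : ℂ) * zStar (Real.sqrt 2) 2 i‖ < 1 / (1 + ∑ i, (|h i| : ℝ)) ^ ω)) ∧
    SB 2 (zStar (Real.sqrt 2) 2) ∧ AlgLiouvilleAdjacent (zStar (Real.sqrt 2) 2) :=
  ⟨zStar_mem_scope_B3 isAlgebraic_sqrt_two irrational_sqrt_two le_rfl,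
    sb_zStar isAlgebraic_sqrt_two le_rfl, algLiouvilleAdjacent_zStar isAlgebraic_sqrt_two le_rfl⟩

/-- **FLAGSHIP CERTIFICATE (hypothesis-free): `(1, iπ)` satisfies `¬P⁺`** — a Liouville `L`
algebraic over `ℚ(iπ)` would give `2 ≤ trdeg ℚ(π, L) ≤ trdeg ℚ(1, iπ, i, L) = trdeg ℚ(1, iπ) ≤ 1`
(`polyMeasure_pi` + extraction).  So the Euler flagship stays in the scope of the shrunk
residual `B₄` (its other three binders: `Literature…linearIndependent_one_piI`, the tree's
`not_liouville_coord_one_piI`-type facts are not needed for `¬P⁺`). -/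
theorem not_algLiouvilleAdjacent_one_piI :
    ¬ AlgLiouvilleAdjacent ![(1 : ℂ), (Real.pi : ℂ) * I] := by
  rintro ⟨L, hL, hLalg⟩
  set S : Set ℂ := Set.range ![(1 : ℂ), (Real.pi : ℂ) * I] with hS
  -- upper bound: trdeg ℚ(S, L, i) = trdeg ℚ(S) ≤ trdeg ℚ(πi) + #{1} ... ≤ 1
  have hSsub : S = ({(Real.pi : ℂ) * I} : Set ℂ) ∪ {(1 : ℂ)} := by
    rw [hS]; ext x; simp [Matrix.range_cons, Matrix.range_empty]; tauto
  have h1 : Algebra.trdeg ℚ ↥(adjoin ℚ S) ≤ 1 := by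
    have ha : Algebra.trdeg ℚ ↥(adjoin ℚ S) = Algebra.trdeg ℚ ↥(adjoin ℚ ({(Real.pi : ℂ) * I} : Set ℂ)) := by
      rw [hSsub]
      exact Literature.Barriers.Schanuel.trdeg_adjoin_union_eq_of_isAlgebraic _ _
        (fun x hx => by rw [Set.mem_singleton_iff] at hx; rw [hx]; exact isAlgebraic_one)
    rw [ha]
    exact (trdeg_adjoin_le_mk (F := ℚ) _).trans (by rw [Cardinal.mk_singleton])
  have h2 : Algebra.trdeg ℚ ↥(adjoin ℚ ((S ∪ {(L : ℂ)}) ∪ {I})) = Algebra.trdeg ℚ ↥(adjoin ℚ S) := by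
    have hA := Literature.Barriers.Schanuel.trdeg_adjoin_union_eq_of_isAlgebraic (K := ℚ)
      (S ∪ {(L : ℂ)}) ({I} : Set ℂ)
      (fun x hx => by rw [Set.mem_singleton_iff] at hx; rw [hx]; exact Literature.Barriers.Schanuel.isAlgebraic_I)
    have hB := Literature.Barriers.Schanuel.trdeg_adjoin_union_eq_of_isAlgebraic_adjoin (K := ℚ)
      S {(L : ℂ)}
      (fun x hx => by rw [Set.mem_singleton_iff] at hx; rw [hx]; exact hLalg)
    exact hA.trans hB
  -- lower bound: π and L lie in ℚ(S, L, i) and are algebraically independent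
  have hai := algebraicIndependent_of_polyMeasure_liouville polyMeasure_pi hL
  set M := adjoin ℚ ((S ∪ {(L : ℂ)}) ∪ {I}) with hM
  have hpiI : (Real.pi : ℂ) * I ∈ M := subset_adjoin ℚ _ (Or.inl (Or.inl ⟨1, by simp⟩))
  have hI : I ∈ M := subset_adjoin ℚ _ (Or.inr rfl)
  have hLM : (L : ℂ) ∈ M := subset_adjoin ℚ _ (Or.inl (Or.inr rfl))
  have hpi : (Real.pi : ℂ) ∈ M := by
    have e : (Real.pi : ℂ) = -(((Real.pi : ℂ) * I) * I) := by
      rw [mul_assoc, Complex.I_mul_I]; ring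
    rw [e]
    exact neg_mem (mul_mem hpiI hI)
  have hlow : (2 : Cardinal) ≤ Algebra.trdeg ℚ ↥M := by
    have := le_trdeg_of_algebraicIndependent hai (M := M)
      (fun i => by fin_cases i <;> assumption)
    simpa using this
  rw [hM, h2] at hlow
  have h21 : (2 : Cardinal) ≤ 1 := hlow.trans h1
  norm_num at h21

/-- **`(1, iπ)` IS IN THE SCOPE OF THE SHRUNK RESIDUAL `B₄` — all FOUR binders certified,
hypothesis-free** (ℚ-free: `Literature.Barriers.Schanuel.linearIndependent_one_piI`; no Liouville
coordinate: the tree's `RootDecomp1KB3LogBarrier.not_liouville_coord_one_piI` (Baker at `n = 1`);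
not `LinLiouville`: the tree's `not_linLiouville_one_pi_I`; `¬P⁺`: previous theorem).  The Euler
flagship — and with it the open core — stays in `B₄`: the shrink removes crypto-Liouville tuples
only. -/
theorem one_pi_I_mem_B4 :
    LinearIndependent ℚ ![(1 : ℂ), (Real.pi : ℂ) * I] ∧
    (¬ ∃ w ∈ Submodule.span ℚ (Set.range ![(1 : ℂ), (Real.pi : ℂ) * I]), Liouville w.re ∨ Liouville w.im) ∧
    (¬ ∀ ω : ℕ, ∃ h : Fin 2 → ℤ, h ≠ 0 ∧
      ‖∑ i, (h i : ℂ) * ![(1 : ℂ), (Real.pi : ℂ) * I] i‖ < 1 / (1 + ∑ i, (|h i| : ℝ)) ^ ω) ∧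
    ¬ AlgLiouvilleAdjacent ![(1 : ℂ), (Real.pi : ℂ) * I] :=
  ⟨Literature.Barriers.Schanuel.linearIndependent_one_piI,
    RootDecomp1KB3LogBarrier.not_liouville_coord_one_piI, not_linLiouville_one_pi_I,
    not_algLiouvilleAdjacent_one_piI⟩

/-- … whereas the `B₄`-INSTANCE at `(1, iπ)` is exactly what the residual still owes: modulo the
binders just certified, `B₄` at `(1, iπ)` reads `2 ≤ trdeg ℚ(1, iπ, e, −1)`, i.e. `e ⟂ π`
(tree: `RootDecomp1KB3LogBarrier.expOnePiAlgebraicIndependent_of_polyDiophantineSchanuel`). -/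
theorem algDiophantineSchanuel_at_one_pi_I (hB₄ : AlgDiophantineSchanuel) :
    ((2 : ℕ) : Cardinal) ≤ Algebra.trdeg ℚ ↥(IntermediateField.adjoin ℚ
      (Set.range ![(1 : ℂ), (Real.pi : ℂ) * I] ∪ Set.range (Complex.exp ∘ ![(1 : ℂ), (Real.pi : ℂ) * I]))) :=
  hB₄ 2 _ one_pi_I_mem_B4.1 one_pi_I_mem_B4.2.1 one_pi_I_mem_B4.2.2.1 one_pi_I_mem_B4.2.2.2

end Summit.Schanuel.Schanuel.Theorems.RootDecomp1KB3LiouvilleSector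

end
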